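import Literature.Topology.FourManifolds.SaddleModel
import Literature.Topology.FourManifolds.GradientLikeDynamics
import Mathlib.Analysis.InnerProductSpace.Calculus
import Mathlib.Analysis.SpecialFunctions.Sqrt
import HarnessLib

/-!
# Flow-polar coordinates on the exit hyperboloid of an index-one saddle in dimension three:
# the planar model

Topic `Literature/Topology/FourManifolds` (support file for the Torelli half of Griffiths'
handlebody theorem, `stmt-SmoothPoincare4-15190`; planar model of `TracePolarChart.lean`).
Everything here is **proved**; the definitions are explicit formulas.

Milnor, *Lectures on the h-cobordism theorem* (1965), Def. 3.1 (2) and proof of Thm. 3.13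
(PDF pp. 12, 18–19): about a critical point of index `1` of a Morse function on a `3`-manifold
there are coordinates `u = (x₁; y₁, y₂)` with `f = c - x₁² + |y⃗|²`; the trajectories leaving a
neighbourhood of the critical point cross the sheet `{-x₁² + |y⃗|² = ε²}` of the level `c + ε²`
(an annulus about the "exit circle" `{x₁ = 0, |y⃗| = ε}` of the unstable disc).  We parametrise
this sheet by the punctured plane, the unit circle corresponding to the exit circle:

* `TracePolar.hypPoint ε w = (ε (r - r⁻¹)/2 ; ε (r + r⁻¹)/2 · w/r)`, `r = ‖w‖` — the point of the
  sheet with "flow-polar coordinates" `w ∈ ℝ² ∖ {0}` (`x₁ = ε sinh s`, `|y⃗| = ε cosh s`,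
  `s = log r`); `TracePolar.polarOut ε u = (x₁ + |y⃗|)/(ε |y⃗|) · y⃗` — the inverse;
* the two maps are mutually inverse (`polarOut_hypPoint`, `hypPoint_polarOut`), smooth off
  `w = 0`, resp. off `y⃗ = 0` (`contDiffAt_hypPoint`, `contDiffAt_polarOut`); the sheet
  identity `Q₁ (hypPoint ε w) = ε²` (`milnorQuadratic_hypPoint`); the size estimate
  `‖hypPoint ε w‖ < 3ε` when `x₁² < ε²` (`norm_hypPoint_lt`); and `x₁ = 0 ↔ ‖w‖ = 1`
  (`xco_eq_zero_iff`).

## References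

* J. Milnor, *Lectures on the h-cobordism theorem* (1965), Def. 3.1 (2), proof of Thm. 3.13
  (PDF pp. 12, 18–19). [MilnorHCobordism1965]
* H. B. Griffiths, *Automorphisms of a 3-dimensional handlebody*, Abh. Math. Sem. Univ. Hamburg
  26 (1964), §3 (meridian neighbourhoods). [GriffithsHB1964Handlebody]
-/

open scoped ContDiff Topology
open Set Function Metric

noncomputable section

namespace Literature.Topology.FourManifolds

namespace TracePolar

/-- Local notation for the model plane and space. -/
local notation "E2" => EuclideanSpace ℝ (Fin 2)
local notation "E3" => EuclideanSpace ℝ (Fin 3)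

/-! ### Coordinates of the model space `ℝ³ = ℝ_{x₁} × ℝ²_{y⃗}` -/

/-- The `y⃗`-part `(u₁, u₂)` of `u = (x₁; y₁, y₂)` as a point of the plane. [cite: MilnorHCobordism1965, Def. 3.1 (2)] -/
def yv (u : E3) : E2 := WithLp.toLp 2 ![u 1, u 2]

/-- `yv_apply_zero`. [folklore] -/
@[simp] theorem yv_apply_zero (u : E3) : yv u 0 = u 1 := rfl
/-- `yv_apply_one`. [folklore] -/
@[simp] theorem yv_apply_one (u : E3) : yv u 1 = u 2 := rfl

/-- Assembling a point of `ℝ³` from `x₁` and `y⃗`. [folklore] -/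
def mk3 (x : ℝ) (y : E2) : E3 := WithLp.toLp 2 ![x, y 0, y 1]

/-- `mk3_apply_zero`. [folklore] -/
@[simp] theorem mk3_apply_zero (x : ℝ) (y : E2) : mk3 x y 0 = x := rfl
/-- `mk3_apply_one`. [folklore] -/
@[simp] theorem mk3_apply_one (x : ℝ) (y : E2) : mk3 x y 1 = y 0 := rfl
/-- `mk3_apply_two`. [folklore] -/
@[simp] theorem mk3_apply_two (x : ℝ) (y : E2) : mk3 x y 2 = y 1 := rfl

/-- `yv_mk3`. [folklore] -/
@[simp] theorem yv_mk3 (x : ℝ) (y : E2) : yv (mk3 x y) = y := by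
  ext i; fin_cases i <;> rfl

/-- `mk3_zero_yv`. [folklore] -/
theorem mk3_zero_yv (u : E3) : mk3 (u 0) (yv u) = u := by
  ext i; fin_cases i <;> rfl

/-- `‖y⃗‖²` in coordinates. [folklore] -/
theorem norm_sq_E2 (y : E2) : ‖y‖ ^ 2 = y 0 ^ 2 + y 1 ^ 2 := by
  rw [EuclideanSpace.real_norm_sq_eq, Fin.sum_univ_two]

/-- `|x⃗|²` for index `1` is `x₁²`. [folklore] -/
theorem sqSumLT_one (u : E3) : sqSumLT 1 u = u 0 ^ 2 := by
  rw [sqSumLT]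
  have h : Finset.univ.filter (fun i : Fin 3 => (i : ℕ) < 1) = {0} := by decide
  rw [h, Finset.sum_singleton]

/-- `|y⃗|²` for index `1` is `‖y⃗‖²`. [folklore] -/
theorem sqSumGE_one (u : E3) : sqSumGE 1 u = ‖yv u‖ ^ 2 := by
  rw [sqSumGE, norm_sq_E2]
  have h : Finset.univ.filter (fun i : Fin 3 => 1 ≤ (i : ℕ)) = {1, 2} := by decide
  rw [h, Finset.sum_pair (by decide)]
  rfl

/-- `Q₁ u = -x₁² + ‖y⃗‖²`. [folklore] -/
theorem milnorQuadratic_one (u : E3) : milnorQuadratic 1 u = -(u 0) ^ 2 + ‖yv u‖ ^ 2 := by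
  rw [milnorQuadratic_eq, sqSumLT_one, sqSumGE_one]

/-- `‖u‖² = x₁² + ‖y⃗‖²`. [folklore] -/
theorem norm_sq_E3 (u : E3) : ‖u‖ ^ 2 = u 0 ^ 2 + ‖yv u‖ ^ 2 := by
  rw [← sqSumLT_add_sqSumGE 1 u, sqSumLT_one, sqSumGE_one]

/-- `mk3` is smooth in its arguments. [folklore] -/
theorem contDiff_mk3 : ContDiff ℝ ∞ (fun p : ℝ × E2 => mk3 p.1 p.2) := by
  rw [contDiff_euclidean]
  intro i
  fin_cases i
  · exact contDiff_fst
  · exact (contDiff_euclidean.1 (contDiff_id (E := E2)) 0).comp contDiff_snd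
  · exact (contDiff_euclidean.1 (contDiff_id (E := E2)) 1).comp contDiff_snd

/-- `yv` is smooth (linear). [folklore] -/
theorem contDiff_yv : ContDiff ℝ ∞ yv := by
  rw [contDiff_euclidean]
  intro i
  fin_cases i
  · exact contDiff_euclidean.1 (contDiff_id (E := E3)) 1
  · exact contDiff_euclidean.1 (contDiff_id (E := E3)) 2

/-! ### The flow-polar parametrisation of the exit sheet -/

/-- **The `x₁`-coordinate `ε (r - r⁻¹)/2` of the flow-polar point `w`**, `r = ‖w‖`. [cite: MilnorHCobordism1965, proof of Thm. 3.13] -/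
def xco (ε : ℝ) (w : E2) : ℝ := ε * (‖w‖ - ‖w‖⁻¹) / 2

/-- **The radial factor `ε (r + r⁻¹)/(2 r)` of the `y⃗`-part.** [folklore] -/
def yfac (ε : ℝ) (w : E2) : ℝ := ε * (‖w‖ + ‖w‖⁻¹) / (2 * ‖w‖)

/-- **The point of the exit sheet `{-x₁² + |y⃗|² = ε²}` with flow-polar coordinates `w ≠ 0`**:
`x₁ = ε (r - r⁻¹)/2`, `y⃗ = ε (r + r⁻¹)/2 · w/r`. [cite: MilnorHCobordism1965, Def. 3.1 (2), proof of Thm. 3.13] -/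
def hypPoint (ε : ℝ) (w : E2) : E3 := mk3 (xco ε w) (yfac ε w • w)

/-- **The flow-polar coordinates of a point `u = (x₁; y⃗)` of the sheet**:
`(x₁ + ‖y⃗‖)/(ε ‖y⃗‖) · y⃗`. [cite: MilnorHCobordism1965, proof of Thm. 3.13] -/
def polarOut (ε : ℝ) (u : E3) : E2 := ((u 0 + ‖yv u‖) / (ε * ‖yv u‖)) • yv u

variable {ε : ℝ}

/-- `hypPoint_apply_zero`. [folklore] -/
theorem hypPoint_apply_zero (w : E2) : hypPoint ε w 0 = xco ε w := rfl

/-- `yv_hypPoint`. [folklore] -/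
theorem yv_hypPoint (w : E2) : yv (hypPoint ε w) = yfac ε w • w := yv_mk3 _ _

/-- The radial factor is positive (`ε > 0`, `w ≠ 0`). [folklore] -/
theorem yfac_pos (hε : 0 < ε) {w : E2} (hw : w ≠ 0) : 0 < yfac ε w := by
  have hr : 0 < ‖w‖ := norm_pos_iff.2 hw
  unfold yfac; positivity

/-- `‖y⃗ (hypPoint w)‖ = ε (r + r⁻¹)/2`. [folklore] -/
theorem norm_yv_hypPoint (hε : 0 < ε) {w : E2} (hw : w ≠ 0) :
    ‖yv (hypPoint ε w)‖ = ε * (‖w‖ + ‖w‖⁻¹) / 2 := by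
  have hr : 0 < ‖w‖ := norm_pos_iff.2 hw
  rw [yv_hypPoint, norm_smul, Real.norm_eq_abs, abs_of_pos (yfac_pos hε hw), yfac]
  field_simp

/-- **The sheet identity**: `Q₁ (hypPoint ε w) = ε²` (`cosh² - sinh² = 1`). [cite: MilnorHCobordism1965, Def. 3.1 (2)] -/
theorem milnorQuadratic_hypPoint (hε : 0 < ε) {w : E2} (hw : w ≠ 0) :
    milnorQuadratic 1 (hypPoint ε w) = ε ^ 2 := by
  have hr : 0 < ‖w‖ := norm_pos_iff.2 hw
  rw [milnorQuadratic_one, norm_yv_hypPoint hε hw, hypPoint_apply_zero, xco]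
  field_simp
  ring

/-- `|x⃗|²` of the flow-polar point is `xco²`. [folklore] -/
theorem sqSumLT_hypPoint (w : E2) : sqSumLT 1 (hypPoint ε w) = xco ε w ^ 2 := by
  rw [sqSumLT_one, hypPoint_apply_zero]

/-- `‖hypPoint ε w‖² = ε² + 2 x₁²`. [folklore] -/
theorem norm_hypPoint_sq (hε : 0 < ε) {w : E2} (hw : w ≠ 0) :
    ‖hypPoint ε w‖ ^ 2 = ε ^ 2 + 2 * xco ε w ^ 2 := by
  have h := milnorQuadratic_hypPoint hε hw
  rw [milnorQuadratic_one] at h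
  rw [norm_sq_E3, hypPoint_apply_zero] at *
  linarith

/-- **Size**: if `x₁² < ε²` then `‖hypPoint ε w‖ < 3ε` (indeed `< √3 ε`). [folklore] -/
theorem norm_hypPoint_lt (hε : 0 < ε) {w : E2} (hw : w ≠ 0) (hx : xco ε w ^ 2 < ε ^ 2) :
    ‖hypPoint ε w‖ < 3 * ε := by
  have h := norm_hypPoint_sq hε hw
  nlinarith [norm_nonneg (hypPoint ε w)]

/-- More generally `‖hypPoint ε w‖ < 3ε` as soon as `x₁² < 4ε²`. [folklore] -/
theorem norm_hypPoint_lt' (hε : 0 < ε) {w : E2} (hw : w ≠ 0) (hx : xco ε w ^ 2 < 4 * ε ^ 2) :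
    ‖hypPoint ε w‖ < 3 * ε := by
  have h := norm_hypPoint_sq hε hw
  nlinarith [norm_nonneg (hypPoint ε w)]

/-- **`x₁ = 0` exactly on the unit circle.** [folklore] -/
theorem xco_eq_zero_iff (hε : 0 < ε) {w : E2} (hw : w ≠ 0) : xco ε w = 0 ↔ ‖w‖ = 1 := by
  have hr : 0 < ‖w‖ := norm_pos_iff.2 hw
  unfold xco
  constructor
  · intro h
    have h1 : ‖w‖ - ‖w‖⁻¹ = 0 := by
      rcases mul_eq_zero.1 (div_eq_zero_iff.1 h |>.resolve_right two_ne_zero) with h2 | h2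
      · exact absurd h2 hε.ne'
      · exact h2
    have h2 : ‖w‖ * ‖w‖ = 1 := by
      have : ‖w‖ = ‖w‖⁻¹ := sub_eq_zero.1 h1
      rw [mul_comm]; nth_rewrite 1 [this]; exact inv_mul_cancel₀ hr.ne'
    nlinarith
  · intro h; rw [h]; simp

/-- `xco` on the unit circle. [folklore] -/
theorem xco_of_norm_eq_one {w : E2} (hw : ‖w‖ = 1) : xco ε w = 0 := by
  unfold xco; rw [hw]; simp

/-- `hypPoint` on the unit circle: `(0 ; ε w)`. [folklore] -/
theorem hypPoint_of_norm_eq_one {w : E2} (hw : ‖w‖ = 1) : hypPoint ε w = mk3 0 (ε • w) := by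
  rw [hypPoint, xco_of_norm_eq_one hw, yfac, hw]; norm_num

/-! ### The inverse -/

/-- **`polarOut ∘ hypPoint = id` off the origin.** [folklore] -/
theorem polarOut_hypPoint (hε : 0 < ε) {w : E2} (hw : w ≠ 0) : polarOut ε (hypPoint ε w) = w := by
  have hr : 0 < ‖w‖ := norm_pos_iff.2 hw
  have hn := norm_yv_hypPoint hε hw
  have hpos : 0 < ‖yv (hypPoint ε w)‖ := by rw [hn]; positivity
  rw [polarOut, hypPoint_apply_zero, yv_hypPoint, smul_smul]
  conv_rhs => rw [← one_smul ℝ w]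
  congr 1
  rw [yv_hypPoint] at hn
  rw [hn, xco, yfac]
  field_simp
  ring

/-- On the sheet, `‖y⃗‖² = ε² + x₁²`, so `y⃗ ≠ 0` and `x₁ + ‖y⃗‖ > 0`. [folklore] -/
theorem norm_yv_sq_of_sheet {u : E3} (hu : milnorQuadratic 1 u = ε ^ 2) : ‖yv u‖ ^ 2 = ε ^ 2 + u 0 ^ 2 := by
  rw [milnorQuadratic_one] at hu; linarith

/-- `norm_yv_pos_of_sheet`. [folklore] -/
theorem norm_yv_pos_of_sheet (hε : 0 < ε) {u : E3} (hu : milnorQuadratic 1 u = ε ^ 2) : 0 < ‖yv u‖ := by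
  have h := norm_yv_sq_of_sheet hu
  have h2 : 0 < ‖yv u‖ ^ 2 := by rw [h]; positivity
  rcases (norm_nonneg (yv u)).lt_or_eq with h3 | h3
  · exact h3
  · rw [← h3] at h2; simp at h2

/-- `yv_ne_zero_of_sheet`. [folklore] -/
theorem yv_ne_zero_of_sheet (hε : 0 < ε) {u : E3} (hu : milnorQuadratic 1 u = ε ^ 2) : yv u ≠ 0 :=
  norm_pos_iff.1 (norm_yv_pos_of_sheet hε hu)

/-- `add_norm_yv_pos_of_sheet`. [folklore] -/
theorem add_norm_yv_pos_of_sheet (hε : 0 < ε) {u : E3} (hu : milnorQuadratic 1 u = ε ^ 2) : 0 < u 0 + ‖yv u‖ := by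
  have h := norm_yv_sq_of_sheet hu
  have hy := norm_yv_pos_of_sheet hε hu
  -- `‖y⃗‖ > |x₁| ≥ -x₁`
  by_contra hle
  have h1 : ‖yv u‖ ≤ -u 0 := by linarith [not_lt.1 hle]
  have h2 : ‖yv u‖ ^ 2 ≤ (u 0) ^ 2 := by nlinarith
  nlinarith [pow_pos hε 2]

/-- `‖polarOut ε u‖ = (x₁ + ‖y⃗‖)/ε` on the sheet. [folklore] -/
theorem norm_polarOut (hε : 0 < ε) {u : E3} (hu : milnorQuadratic 1 u = ε ^ 2) :
    ‖polarOut ε u‖ = (u 0 + ‖yv u‖) / ε := by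
  have hy := norm_yv_pos_of_sheet hε hu
  have hp := add_norm_yv_pos_of_sheet hε hu
  rw [polarOut, norm_smul, Real.norm_eq_abs, abs_of_pos (by positivity)]
  field_simp

/-- `polarOut` does not vanish on the sheet. [folklore] -/
theorem polarOut_ne_zero (hε : 0 < ε) {u : E3} (hu : milnorQuadratic 1 u = ε ^ 2) : polarOut ε u ≠ 0 := by
  rw [← norm_pos_iff, norm_polarOut hε hu]
  exact div_pos (add_norm_yv_pos_of_sheet hε hu) hε

/-- **`hypPoint ∘ polarOut = id` on the sheet.** [folklore] -/
theorem hypPoint_polarOut (hε : 0 < ε) {u : E3} (hu : milnorQuadratic 1 u = ε ^ 2) :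
    hypPoint ε (polarOut ε u) = u := by
  have hy := norm_yv_pos_of_sheet hε hu
  have hp := add_norm_yv_pos_of_sheet hε hu
  have hsq := norm_yv_sq_of_sheet hu
  have hr := norm_polarOut hε hu
  set r := ‖polarOut ε u‖ with hrdef
  have hr0 : 0 < r := by rw [hr]; positivity
  -- the `x₁`-coordinate
  have hx : xco ε (polarOut ε u) = u 0 := by
    rw [xco, ← hrdef, hr]
    field_simp
    nlinarith [hsq]
  -- the `y⃗`-part
  have hyf : yfac ε (polarOut ε u) • polarOut ε u = yv u := by
    rw [polarOut, smul_smul, yfac, ← polarOut, ← hrdef, hr]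
    conv_rhs => rw [← one_smul ℝ (yv u)]
    congr 1
    field_simp
    nlinarith [hsq]
  rw [hypPoint, hx, hyf, mk3_zero_yv]

/-- **`xco (polarOut u) = x₁`** on the sheet. [folklore] -/
theorem xco_polarOut (hε : 0 < ε) {u : E3} (hu : milnorQuadratic 1 u = ε ^ 2) : xco ε (polarOut ε u) = u 0 := by
  have h := congrArg (fun v : E3 => v 0) (hypPoint_polarOut hε hu)
  simpa [hypPoint_apply_zero] using h

/-! ### Smoothness -/

/-- `xco` is smooth off the origin. [folklore] -/
theorem contDiffAt_xco {w : E2} (hw : w ≠ 0) : ContDiffAt ℝ ∞ (xco ε) w := by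
  have h1 : ContDiffAt ℝ ∞ (fun w : E2 => ‖w‖) w := contDiffAt_norm ℝ hw
  have h2 : ContDiffAt ℝ ∞ (fun w : E2 => ‖w‖⁻¹) w := h1.inv (norm_ne_zero_iff.2 hw)
  exact ((contDiffAt_const.mul (h1.sub h2)).div_const 2)

/-- `yfac` is smooth off the origin. [folklore] -/
theorem contDiffAt_yfac {w : E2} (hw : w ≠ 0) : ContDiffAt ℝ ∞ (yfac ε) w := by
  have h1 : ContDiffAt ℝ ∞ (fun w : E2 => ‖w‖) w := contDiffAt_norm ℝ hw
  have h2 : ContDiffAt ℝ ∞ (fun w : E2 => ‖w‖⁻¹) w := h1.inv (norm_ne_zero_iff.2 hw)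
  exact (contDiffAt_const.mul (h1.add h2)).div (contDiffAt_const.mul h1)
    (mul_ne_zero two_ne_zero (norm_ne_zero_iff.2 hw))

/-- **`hypPoint` is smooth off the origin.** [folklore] -/
theorem contDiffAt_hypPoint {w : E2} (hw : w ≠ 0) : ContDiffAt ℝ ∞ (hypPoint ε) w := by
  have h : ContDiffAt ℝ ∞ (fun w : E2 => (xco ε w, yfac ε w • w)) w :=
    (contDiffAt_xco hw).prodMk ((contDiffAt_yfac hw).smul contDiffAt_id)
  exact contDiff_mk3.contDiffAt.comp w h

/-- **`polarOut` is smooth off `{y⃗ = 0}`.** [folklore] -/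
theorem contDiffAt_polarOut {u : E3} (hu : yv u ≠ 0) : ContDiffAt ℝ ∞ (polarOut ε) u := by
  have hyv : ContDiffAt ℝ ∞ yv u := contDiff_yv.contDiffAt
  have hn : ContDiffAt ℝ ∞ (fun u : E3 => ‖yv u‖) u := (contDiffAt_norm ℝ hu).comp u hyv
  have h0 : ContDiffAt ℝ ∞ (fun u : E3 => u 0) u := (contDiff_euclidean.1 (contDiff_id (E := E3)) 0).contDiffAt
  by_cases hε : ε = 0
  · -- degenerate parameter: the map is `u ↦ (…/0) • yv u = 0 • …`, still smooth
    have : polarOut ε = fun u => ((u 0 + ‖yv u‖) / (ε * ‖yv u‖)) • yv u := rfl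
    rw [this]
    simp only [hε, zero_mul, div_zero, zero_smul]
    exact contDiffAt_const
  · exact ((h0.add hn).div (contDiffAt_const.mul hn) (mul_ne_zero hε (norm_ne_zero_iff.2 hu))).smul hyv

/-- `polarOut` is smooth at the points of the sheet. [folklore] -/
theorem contDiffAt_polarOut_of_sheet (hε : 0 < ε) {u : E3} (hu : milnorQuadratic 1 u = ε ^ 2) :
    ContDiffAt ℝ ∞ (polarOut ε) u :=
  contDiffAt_polarOut (yv_ne_zero_of_sheet hε hu)

end TracePolar

end Literature.Topology.FourManifolds
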